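import Summits.QuantumFields.YangMills.Theorems.UnitScaleTiltProp8ChartTransport
import Literature.MathematicalPhysics.QuantumFieldTheory.Balaban1983to89.Node00.HistoryTransportOfRecord
import Literature.MathematicalPhysics.QuantumFieldTheory.Balaban1983to89.B12RegularSpaces111SpecialUnitary
import HarnessLib

/-!
# BalabanUVNodes ∕ node N18 = NE5 — closure-ledger item (iii): THE TRANSPORTED PAIR IS `Gᶜ = SL(N, ℂ)`-VALUED — the letter `hUGc` of the (T3) letter form for
# `TΦOfRecord`, from `SL(N, ℂ)`-valued small fields (print's «It is a Gᶜ-valued function», [Balaban1987RG1] p.253, for the (0.4) average of record)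
# (Track A, DAG node N18 = `T4OutputRate.NE5` :211; cluster K4 «SpineRates», item K3⁷ `SpineGivenEndpointR13SepCoPH`; seat pub-ymgap-dag-n18-w3 g3)

HONEST FRAMING.  Count-neutral kernel bookkeeping (`--supports stmt-QuantumFields-20544 --as helper`): group bookkeeping (transports of a subgroup-valued field stay
in the subgroup) + the tree's `ExpMeanLog.det_eml_eq_one` (Liouville: `det e^{mean log} = e^{mean tr log} = 1` on `SL(N, ℂ)` near `1`) + UST's loop letter
`Prop8Chart.norm_loopHolU_sub_one_le`; ONE of the letters of `…N18TransportLettersOfRecord`'s letter data (`hUGc`) becomes a bond-level smallness hypothesis.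
Nothing of Bałaban's RG asserted; NE5 NOT PRINTED ∕ NOT proved; N18 NOT discharged; nothing about the continuum ∕ OS ∕ mass gap ∕ Clay.

WHAT.
* §1 `holT_mem` (the transport of an `H`-valued field along any word lies in `H`, any subgroup `H` of any group), `loopVarU_mem`, `straightU_mem`.
* §2 ★ `det_avgUnits_eq_one` ∕ ★ `avgUnits_mem_suModel_Gc` — for an `SL(N, ℂ)`-valued field whose (0.4) loop variables at `c` are within `1∕3` of `1` with
  `N·‖W_i − 1‖ < π`, `Ū(c) = eml(W)·𝐔(straight) ∈ SL(N, ℂ)`; ★ `avgUnits_mem_suModel_Gc_of_near` — the same from BOND-level smallness `‖𝐔(b) − 1‖ ≤ s` on the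
  two blocks of `c` with `4ℓs ≤ 1∕3`, `N·4ℓs < π` (`ℓ = (d+2)L`; UST `norm_loopHolU_sub_one_le`).
* §3 ★★ `TΦOfRecord_U_mem_suModel_Gc_of_near` — the letter `hUGc` of `exists_orbit_TΦOfRecord_of_letters(_su)` for W1-18's transport of record, read on run
  `k`'s unit lattice through `bondShift` (`TΦOfRecord_U`).

0 `def`, 0 `sorry`.  References: T. Bałaban, CMP **109** (1987) 249–301 [Balaban1987RG1] ((0.4)–(0.5) p.253, (1.10) p.262); CMP **98** (1985) 17–51
[Balaban1985Averaging] ((122)–(123) p.36).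
-/

noncomputable section

open scoped BigOperators Matrix.Norms.L2Operator

namespace YMDAG.N18.TransportOfRecord

open Literature.MathematicalPhysics.QuantumFieldTheory.Balaban1983to89
open Literature.MathematicalPhysics.QuantumFieldTheory.Balaban1983to89.T4Continuum
open Literature.MathematicalPhysics.QuantumFieldTheory.Balaban1983to89.T4LevelShift
open Literature.MathematicalPhysics.QuantumFieldTheory.Balaban1983to89.BlockAveraging
open Literature.MathematicalPhysics.QuantumFieldTheory.Balaban1983to89.B10Eq27TorusAxialLog (holT holT_nil holT_cons_true holT_cons_false)
open Literature.MathematicalPhysics.QuantumFieldTheory.Balaban1983to89.ExpMeanLog (eml det_eml_eq_one)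
open Literature.MathematicalPhysics.QuantumFieldTheory.Balaban1983to89.B12RegularSpaces111SpecialUnitary (suModel mem_suModel_Gc)
open Literature.MathematicalPhysics.QuantumFieldTheory.Balaban1983to89.Node00 (MatA)
open Literature.MathematicalPhysics.QuantumFieldTheory.Balaban1983to89.Node00.W1
open Summit.QuantumFields.YangMills.Theorems.Prop8Chart (loopHolU norm_loopHolU_sub_one_le)

/-! ## §1 Transports of a subgroup-valued field stay in the subgroup -/

section Group

variable {P : Params} {j : ℕ} {G : Type*} [Group G]

/-- The transport of an `H`-valued configuration along any lattice word lies in `H` (products of bond variables and their inverses).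
[cite: Balaban1985Averaging, (9) p.19 (bookkeeping)] -/
theorem holT_mem (H : Subgroup G) {V : GaugeField P j G} (hV : ∀ b, V b ∈ H) :
    ∀ (x : Site P j) (w : List (Letter P.d)), holT V x w ∈ H
  | x, [] => by rw [holT_nil]; exact H.one_mem
  | x, (μ, true) :: w => by rw [holT_cons_true]; exact H.mul_mem (hV _) (holT_mem H hV _ w)
  | x, (μ, false) :: w => by rw [holT_cons_false]; exact H.mul_mem (H.inv_mem (hV _)) (holT_mem H hV _ w)

variable {𝔸 : Type*} [NormedRing 𝔸]

/-- The (0.4) loop variables of an `H`-valued field lie in `H`. [cite: Balaban1987RG1, (0.4) p.253 (bookkeeping)] -/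
theorem loopVarU_mem (H : Subgroup 𝔸ˣ) {U : GaugeField P j 𝔸ˣ} (hU : ∀ b, U b ∈ H) (c : PBond P (j + 1)) (i : Idx P) :
    loopVarU U c i ∈ H :=
  holT_mem H hU _ _

/-- The straight transporter of an `H`-valued field lies in `H`. [cite: Balaban1987RG1, (0.4) p.253 (bookkeeping)] -/
theorem straightU_mem (H : Subgroup 𝔸ˣ) {U : GaugeField P j 𝔸ˣ} (hU : ∀ b, U b ∈ H) (c : PBond P (j + 1)) : straightU U c ∈ H :=
  holT_mem H hU _ _

end Group

/-! ## §2 The complexified (0.4) average of an `SL(N, ℂ)`-valued small field is `SL(N, ℂ)`-valued -/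

section SL

variable {P : Params} {j : ℕ} {N : ℕ}

/-- ★ **`det Ū(c) = 1`** for an `SL(N, ℂ)`-valued field whose (0.4) loop variables at `c` are within `1∕3` of `1` with `N·‖W_i − 1‖ < π`:
`Ū(c) = eml(W)·𝐔(straight)`, `det eml(W) = 1` by Liouville (`ExpMeanLog.det_eml_eq_one`), `det 𝐔(straight) = 1` (a product in `SL(N, ℂ)`).
[cite: Balaban1987RG1, before (0.5) p.253 («It is a Gᶜ-valued function»)] -/
theorem det_avgUnits_eq_one {U : GaugeField P j (MatA N)ˣ} (hU : ∀ b, U b ∈ (suModel N).Gc) (c : PBond P (j + 1))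
    (hs : ∀ i : Idx P, ‖((loopVarU U c i : (MatA N)ˣ) : MatA N) - 1‖ ≤ 1 / 3)
    (hπ : ∀ i : Idx P, Fintype.card (Fin N) * ‖((loopVarU U c i : (MatA N)ˣ) : MatA N) - 1‖ < Real.pi) :
    Matrix.det ((avgUnits U c : (MatA N)ˣ) : MatA N) = 1 := by
  rw [val_avgUnits, Matrix.det_mul, det_eml_eq_one (fun i => mem_suModel_Gc.1 (loopVarU_mem _ hU c i)) hs hπ, one_mul]
  exact mem_suModel_Gc.1 (straightU_mem _ hU c)

/-- ★ **`Ū(c) ∈ Gᶜ = SL(N, ℂ)`** under the same hypotheses. [cite: Balaban1987RG1, before (0.5) p.253] -/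
theorem avgUnits_mem_suModel_Gc {U : GaugeField P j (MatA N)ˣ} (hU : ∀ b, U b ∈ (suModel N).Gc) (c : PBond P (j + 1))
    (hs : ∀ i : Idx P, ‖((loopVarU U c i : (MatA N)ˣ) : MatA N) - 1‖ ≤ 1 / 3)
    (hπ : ∀ i : Idx P, Fintype.card (Fin N) * ‖((loopVarU U c i : (MatA N)ˣ) : MatA N) - 1‖ < Real.pi) :
    avgUnits U c ∈ (suModel N).Gc :=
  mem_suModel_Gc.2 (det_avgUnits_eq_one hU c hs hπ)

/-- ★ **`Ū(c) ∈ SL(N, ℂ)` FROM BOND-LEVEL SMALLNESS**: `𝐔` `SL(N, ℂ)`-valued, `‖𝐔(b) − 1‖ ≤ s` on the two-block bonds of `c`, `4ℓs ≤ 1∕3` and `N·4ℓs < π`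
(`ℓ = (d+2)L`; the loop variables are then within `4ℓs` of `1`, UST `Prop8Chart.norm_loopHolU_sub_one_le`). [cite: Balaban1987RG1, before (0.5) p.253; Balaban1985Averaging, (122)-(123) p.36] -/
theorem avgUnits_mem_suModel_Gc_of_near [NeZero N] (hj : j + 1 ≤ P.m + P.K) {U : GaugeField P j (MatA N)ˣ} (hU : ∀ b, U b ∈ (suModel N).Gc)
    (c : PBond P (j + 1)) {s : ℝ} (hs0 : 0 ≤ s) (hℓs : 4 * (((P.d + 2) * P.L : ℕ) : ℝ) * s ≤ 1 / 3)
    (hπ : (N : ℝ) * (4 * (((P.d + 2) * P.L : ℕ) : ℝ) * s) < Real.pi)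
    (hS : ∀ b : PBond P j, (blockOf b.src = c.src ∨ blockOf b.src = c.tgt) → (blockOf b.tgt = c.src ∨ blockOf b.tgt = c.tgt) →
      ‖((U b : (MatA N)ˣ) : MatA N) - 1‖ ≤ s) :
    avgUnits U c ∈ (suModel N).Gc := by
  have hloop : ∀ i : Idx P, ‖((loopVarU U c i : (MatA N)ˣ) : MatA N) - 1‖ ≤ 4 * (((P.d + 2) * P.L : ℕ) : ℝ) * s :=
    fun i => (norm_loopHolU_sub_one_le hj c hs0 (hℓs.trans (by norm_num)) hS i).1
  refine avgUnits_mem_suModel_Gc hU c (fun i => (hloop i).trans hℓs) fun i => ?_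
  rw [Fintype.card_fin]
  calc (N : ℝ) * ‖((loopVarU U c i : (MatA N)ˣ) : MatA N) - 1‖ ≤ (N : ℝ) * (4 * (((P.d + 2) * P.L : ℕ) : ℝ) * s) :=
        mul_le_mul_of_nonneg_left (hloop i) (Nat.cast_nonneg N)
    _ < Real.pi := hπ

end SL


/-! ## §4 Factorised fields `𝐔 = e·U` with `U` unitary-like and `e` near `1`: transports to first order, and `Ū ∈ SL(N, ℂ)` from the loops of the factor -/

section Factor

variable {P : Params} {j : ℕ} {𝔸 : Type*} [NormedRing 𝔸] [NormOneClass 𝔸]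

/-- The transport of a field whose bond variables and their inverses have norm `≤ 1` (e.g. unitary-valued) has norm `≤ 1`. [folklore] -/
theorem norm_holT_le_one {U : GaugeField P j 𝔸ˣ} (hU : ∀ b, ‖((U b : 𝔸ˣ) : 𝔸)‖ ≤ 1) (hU' : ∀ b, ‖(((U b)⁻¹ : 𝔸ˣ) : 𝔸)‖ ≤ 1) :
    ∀ (x : Site P j) (w : List (Letter P.d)), ‖((holT U x w : 𝔸ˣ) : 𝔸)‖ ≤ 1
  | x, [] => by rw [holT_nil, Units.val_one, norm_one]
  | x, (μ, true) :: w => by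
    rw [holT_cons_true, Units.val_mul]
    exact (norm_mul_le _ _).trans (mul_le_one₀ (hU _) (norm_nonneg _) (norm_holT_le_one hU hU' _ w))
  | x, (μ, false) :: w => by
    rw [holT_cons_false, Units.val_mul]
    exact (norm_mul_le _ _).trans (mul_le_one₀ (hU' _) (norm_nonneg _) (norm_holT_le_one hU hU' _ w))

/-- ★ **TRANSPORTS OF A FACTORISED FIELD TO FIRST ORDER**: if `𝐔(b) = e(b)·U(b)` with `‖U(b)‖, ‖U(b)⁻¹‖ ≤ 1` and `‖e(b) − 1‖ ≤ ε ≤ ½` on every bond, then along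
any word of length `m`: `‖𝐔(Γ) − U(Γ)‖ ≤ (1 + 2ε)^m − 1` (forward letters cost `ε`, backward letters `‖e⁻¹ − 1‖ ≤ 2ε`; the unitary factors cost nothing).
[cite: Balaban1987RG1, (1.11)-(1.13) p.262 (the factorisation 𝐔 = U′U)] -/
theorem norm_holT_factor_sub_holT_le {Uc U e : GaugeField P j 𝔸ˣ} (hf : ∀ b, Uc b = e b * U b) (hU : ∀ b, ‖((U b : 𝔸ˣ) : 𝔸)‖ ≤ 1)
    (hU' : ∀ b, ‖(((U b)⁻¹ : 𝔸ˣ) : 𝔸)‖ ≤ 1) {ε : ℝ} (hε : ε ≤ 1 / 2) (he : ∀ b, ‖((e b : 𝔸ˣ) : 𝔸) - 1‖ ≤ ε) :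
    ∀ (x : Site P j) (w : List (Letter P.d)), ‖((holT Uc x w : 𝔸ˣ) : 𝔸) - holT U x w‖ ≤ (1 + 2 * ε) ^ w.length - 1
  | x, [] => by simp [holT_nil]
  | x, (μ, true) :: w => by
    have ih := norm_holT_factor_sub_holT_le hf hU hU' hε he (x.shift μ) w
    have hε0 : 0 ≤ ε := (norm_nonneg _).trans (he ⟨x, μ⟩)
    set T' := ((holT Uc (x.shift μ) w : 𝔸ˣ) : 𝔸) with hT'
    set T := ((holT U (x.shift μ) w : 𝔸ˣ) : 𝔸) with hT
    have hTn : ‖T‖ ≤ 1 := norm_holT_le_one hU hU' _ w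
    have hT'n : ‖T'‖ ≤ 1 + ((1 + 2 * ε) ^ w.length - 1) := by
      have := norm_le_norm_add_norm_sub' T' T; linarith
    rw [holT_cons_true, holT_cons_true, Units.val_mul, Units.val_mul, hf ⟨x, μ⟩, Units.val_mul, List.length_cons, pow_succ]
    have e1 : ((e ⟨x, μ⟩ : 𝔸ˣ) : 𝔸) * ((U ⟨x, μ⟩ : 𝔸ˣ) : 𝔸) * T' - ((U ⟨x, μ⟩ : 𝔸ˣ) : 𝔸) * T =
        (((e ⟨x, μ⟩ : 𝔸ˣ) : 𝔸) - 1) * (((U ⟨x, μ⟩ : 𝔸ˣ) : 𝔸) * T') + ((U ⟨x, μ⟩ : 𝔸ˣ) : 𝔸) * (T' - T) := by noncomm_ring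
    rw [e1]
    calc _ ≤ ‖(((e ⟨x, μ⟩ : 𝔸ˣ) : 𝔸) - 1) * (((U ⟨x, μ⟩ : 𝔸ˣ) : 𝔸) * T')‖ + ‖((U ⟨x, μ⟩ : 𝔸ˣ) : 𝔸) * (T' - T)‖ := norm_add_le _ _
      _ ≤ ε * (1 * (1 + ((1 + 2 * ε) ^ w.length - 1))) + 1 * ((1 + 2 * ε) ^ w.length - 1) := by
          gcongr
          · exact (norm_mul_le _ _).trans (mul_le_mul (he _) ((norm_mul_le _ _).trans (mul_le_mul (hU _) hT'n (norm_nonneg _) zero_le_one))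
              (norm_nonneg _) hε0)
          · exact (norm_mul_le _ _).trans (mul_le_mul (hU _) ih (norm_nonneg _) zero_le_one)
      _ ≤ (1 + 2 * ε) ^ w.length * (1 + 2 * ε) - 1 := by
          have hp : 1 ≤ (1 + 2 * ε) ^ w.length := one_le_pow₀ (by linarith)
          nlinarith
  | x, (μ, false) :: w => by
    have ih := norm_holT_factor_sub_holT_le hf hU hU' hε he (x.unshift μ) w
    have hε0 : 0 ≤ ε := (norm_nonneg _).trans (he ⟨x, μ⟩)
    set T' := ((holT Uc (x.unshift μ) w : 𝔸ˣ) : 𝔸) with hT'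
    set T := ((holT U (x.unshift μ) w : 𝔸ˣ) : 𝔸) with hT
    have hTn : ‖T‖ ≤ 1 := norm_holT_le_one hU hU' _ w
    have hT'n : ‖T'‖ ≤ 1 + ((1 + 2 * ε) ^ w.length - 1) := by
      have := norm_le_norm_add_norm_sub' T' T; linarith
    have hinv : ((Uc ⟨x.unshift μ, μ⟩)⁻¹ : 𝔸ˣ) = (U ⟨x.unshift μ, μ⟩)⁻¹ * (e ⟨x.unshift μ, μ⟩)⁻¹ := by
      rw [hf, mul_inv_rev]
    have he' : ‖(((e ⟨x.unshift μ, μ⟩)⁻¹ : 𝔸ˣ) : 𝔸) - 1‖ ≤ 2 * ε :=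
      Summit.QuantumFields.YangMills.Theorems.Prop8Chart.norm_inv_sub_one_le_two_mul (he _) hε
    rw [holT_cons_false, holT_cons_false, hinv, Units.val_mul, Units.val_mul, Units.val_mul, List.length_cons, pow_succ]
    have e1 : (((U ⟨x.unshift μ, μ⟩)⁻¹ : 𝔸ˣ) : 𝔸) * (((e ⟨x.unshift μ, μ⟩)⁻¹ : 𝔸ˣ) : 𝔸) * T' -
          (((U ⟨x.unshift μ, μ⟩)⁻¹ : 𝔸ˣ) : 𝔸) * T =
        (((U ⟨x.unshift μ, μ⟩)⁻¹ : 𝔸ˣ) : 𝔸) * (((((e ⟨x.unshift μ, μ⟩)⁻¹ : 𝔸ˣ) : 𝔸) - 1) * T' + (T' - T)) := by noncomm_ring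
    rw [e1]
    calc _ ≤ 1 * ‖((((e ⟨x.unshift μ, μ⟩)⁻¹ : 𝔸ˣ) : 𝔸) - 1) * T' + (T' - T)‖ :=
          (norm_mul_le _ _).trans (mul_le_mul_of_nonneg_right (hU' _) (norm_nonneg _))
      _ ≤ 1 * (2 * ε * (1 + ((1 + 2 * ε) ^ w.length - 1)) + ((1 + 2 * ε) ^ w.length - 1)) := by
          gcongr
          exact (norm_add_le _ _).trans (add_le_add ((norm_mul_le _ _).trans (mul_le_mul he' hT'n (norm_nonneg _) (by linarith))) ih)
      _ = (1 + 2 * ε) ^ w.length * (1 + 2 * ε) - 1 := by ring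

end Factor

section FactorSL

variable {P : Params} {j : ℕ} {N : ℕ}

/-- ★ **`Ū ∈ SL(N, ℂ)` FOR A FACTORISED PAIR `𝐔 = e·U`** (`e = exp iξA′` near `1`, `U` with unitary-like bond variables, both `SL(N, ℂ)`-valued): if the (0.4)
loop variables of the FACTOR `U` at `c` are within `r` of `1`, `‖e(b) − 1‖ ≤ ε ≤ ½` everywhere, and `r + ((1+2ε)^ℓ − 1) ≤ 1∕3`, `N·(r + ((1+2ε)^ℓ − 1)) < π`
(`ℓ = (d+2)L` bounds the loop lengths), then `Ū(𝐔)(c) ∈ SL(N, ℂ)` — the loops of `𝐔` are those of `U` up to `(1+2ε)^ℓ − 1`. [cite: Balaban1987RG1, before (0.5) p.253, (1.11)-(1.13) p.262] -/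
theorem avgUnits_mem_suModel_Gc_of_factors [NeZero N] {Uc U e : GaugeField P j (MatA N)ˣ} (hf : ∀ b, Uc b = e b * U b)
    (hUc : ∀ b, Uc b ∈ (suModel N).Gc) (hU : ∀ b, ‖((U b : (MatA N)ˣ) : MatA N)‖ ≤ 1) (hU' : ∀ b, ‖(((U b)⁻¹ : (MatA N)ˣ) : MatA N)‖ ≤ 1)
    {ε r : ℝ} (hε : ε ≤ 1 / 2) (he : ∀ b, ‖((e b : (MatA N)ˣ) : MatA N) - 1‖ ≤ ε) (c : PBond P (j + 1))
    (hr : ∀ i : Idx P, ‖((loopVarU U c i : (MatA N)ˣ) : MatA N) - 1‖ ≤ r)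
    (h3 : r + ((1 + 2 * ε) ^ ((P.d + 2) * P.L) - 1) ≤ 1 / 3) (hπ : (N : ℝ) * (r + ((1 + 2 * ε) ^ ((P.d + 2) * P.L) - 1)) < Real.pi) :
    avgUnits Uc c ∈ (suModel N).Gc := by
  have hε0 : 0 ≤ ε := (norm_nonneg _).trans (he ⟨emb c.src, c.dir⟩)
  have hloop : ∀ i : Idx P, ‖((loopVarU Uc c i : (MatA N)ˣ) : MatA N) - 1‖ ≤ r + ((1 + 2 * ε) ^ ((P.d + 2) * P.L) - 1) := fun i => by
    have h1 := norm_holT_factor_sub_holT_le hf hU hU' hε he (emb c.src) (loopWord P.L c.dir (off i.1) i.2.1 i.2.2)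
    have hlen := LatticeWordStokes.length_loopWord_le c i
    have hmono : (1 + 2 * ε) ^ (loopWord P.L c.dir (off i.1) i.2.1 i.2.2).length ≤ (1 + 2 * ε) ^ ((P.d + 2) * P.L) :=
      pow_le_pow_right₀ (by linarith) hlen
    calc ‖((loopVarU Uc c i : (MatA N)ˣ) : MatA N) - 1‖
        ≤ ‖((loopVarU Uc c i : (MatA N)ˣ) : MatA N) - loopVarU U c i‖ + ‖((loopVarU U c i : (MatA N)ˣ) : MatA N) - 1‖ := norm_sub_le_norm_sub_add_norm_sub _ _ _
      _ ≤ ((1 + 2 * ε) ^ ((P.d + 2) * P.L) - 1) + r := add_le_add (h1.trans (by linarith)) (hr i)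
      _ = r + ((1 + 2 * ε) ^ ((P.d + 2) * P.L) - 1) := add_comm _ _
  refine avgUnits_mem_suModel_Gc hUc c (fun i => (hloop i).trans h3) fun i => ?_
  rw [Fintype.card_fin]
  exact (mul_le_mul_of_nonneg_left (hloop i) (Nat.cast_nonneg N)).trans_lt hπ

end FactorSL

/-! ## §3 The letter `hUGc` for the transport of record -/

section Record

variable {F : T4Family} {N k : ℕ}

/-- ★★ **THE TRANSPORTED PAIR IS `SL(N, ℂ)`-VALUED**: for a run-B pair `Φ` with `𝐔` `SL(N, ℂ)`-valued and `‖𝐔(b) − 1‖ ≤ s` on the two blocks of the coarse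
bond `bondShift b` (`4ℓs ≤ 1∕3`, `N·4ℓs < π`), `(TΦOfRecord F N k Φ).U b ∈ SL(N, ℂ) = (suModel N).Gc` — the letter `hUGc` of
`exists_orbit_TΦOfRecord_of_letters_su` at this bond. [cite: Balaban1987RG1, before (0.5) p.253, (1.10) p.262] -/
theorem TΦOfRecord_U_mem_suModel_Gc_of_near [NeZero N] (Φ : FieldPair (F.P (k + 1)) 0 (MatA N)ˣ (MatA N)) (hU : ∀ b, Φ.U b ∈ (suModel N).Gc)
    (b : PBond (F.P k) 0) {s : ℝ} (hs0 : 0 ≤ s) (hℓs : 4 * ((((F.P (k + 1)).d + 2) * (F.P (k + 1)).L : ℕ) : ℝ) * s ≤ 1 / 3)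
    (hπ : (N : ℝ) * (4 * ((((F.P (k + 1)).d + 2) * (F.P (k + 1)).L : ℕ) : ℝ) * s) < Real.pi)
    (hS : ∀ b' : PBond (F.P (k + 1)) 0,
      (blockOf b'.src = (bondShift (sitesPerDir_ladder F (K := k) (j := 0) rfl rfl) b).src ∨
          blockOf b'.src = (bondShift (sitesPerDir_ladder F (K := k) (j := 0) rfl rfl) b).tgt) →
        (blockOf b'.tgt = (bondShift (sitesPerDir_ladder F (K := k) (j := 0) rfl rfl) b).src ∨
          blockOf b'.tgt = (bondShift (sitesPerDir_ladder F (K := k) (j := 0) rfl rfl) b).tgt) →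
        ‖((Φ.U b' : (MatA N)ˣ) : MatA N) - 1‖ ≤ s) :
    (TΦOfRecord F N k Φ).U b ∈ (suModel N).Gc := by
  rw [TΦOfRecord_U]
  exact avgUnits_mem_suModel_Gc_of_near (by simp only [T4Family.P_m, T4Family.P_K]; omega) hU _ hs0 hℓs hπ hS

end Record

end YMDAG.N18.TransportOfRecord

end
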